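/-
NEW (pub-hodgecm2, COR-CM cell = stage 2 of the Hodge ladder; MODEL-UNIVERSE BUILDER 1 = seat model-1, gen 24).
Close-out of the model layer: `Model.modelAxioms_of_riemann` (p237558, `CorCM/Model/ModelAxiomsOfRiemann.lean`) took
stage 1's cited record `hR : DeligneMilne1982_Thm_6_20_full` (binder B02) as its only hypothesis besides the displayed
data; that record is now the tree theorem `HodgeTheory.deligneMilne1982_Thm_6_20_full_holds`
(`Literature/AlgebraicGeometry/HodgeTheory/AbelianVarietyHodgeFullnessHolds.lean`, row D1-U), so the 28-field
`ModelAxioms` of the Picard–CM model universe holds over the displayed data `hHD hI hU h₃` alone.  Count-neutral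
(no BINDER-OWNERS row; MODEL-SCOPE-CORCM.md §6: the two rows M20 `cmDominated` / M21 `conjIsogeny` that were
"theorems modulo B02" become unconditional).  Proofs only; no definition, no named fact.
-/
import Summits.HodgeConjecture.CorCM.Model.ModelAxiomsOfRiemann
import Literature.AlgebraicGeometry.HodgeTheory.AbelianVarietyHodgeFullnessHolds
import HarnessLib

/-!
# COR-CM — the model universe satisfies `ModelAxioms` (no Riemann binder)

For the Picard–CM model universe `U₀ := Model.universeOf hHD hI hU h₃` (`CorCM/Model/Universe.lean`) the structural
record `U₀.ModelAxioms` (`CorCM/Geometry/Facts.lean`, the 28 fields M01–M28 of stage 1's `MODEL-SCOPE.md`) HOLDS,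
given only the displayed data `hHD hI hU h₃` from which `U₀` is built:

* `Model.modelAxioms_holds` — `Model.modelAxioms_of_riemann` (every field the junction theorem of its row, row M22
  `Fact_algDuality` by `Model.universeOf_algDuality`) with its last named hypothesis, Riemann's theorem
  (Deligne–Milne 1982 Thm. 6.20, fullness of `A ↦ H¹_B(A)`; it entered through rows M20/M21 only), supplied by the
  tree theorem `deligneMilne1982_Thm_6_20_full_holds` (uniformisation of complex abelian varieties by complex tori,
  [LangeBirkenhake1992] Lemma 1.1.2 / Thm. 1.1.21, + GAGA for maps).
* `Model.picardCMUniverse_modelAxioms` — the same for the model of record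
  `Model.picardCMUniverse hHD hI h₁ h₃ = universeOf hHD hI (ballQuotientUniformisedDatum_of h₁) h₃` (`rfl`).

Nothing is asserted: every field is a hub-tree theorem; axioms `propext`, `Classical.choice`, `Quot.sound`.

References: [DeligneMilne1982Tannakian] Thm. 6.20; [LangeBirkenhake1992] Ch. 1 §1.
-/

noncomputable section

namespace Summit.HodgeConjecture.CorCM

open Literature.NumberTheory.Automorphic.PicardCM
open Literature.AlgebraicGeometry.HodgeTheory

namespace Model

/-- **The Picard–CM model universe satisfies `ModelAxioms`.**  All 28 fields of
`(universeOf hHD hI hU h₃).ModelAxioms` are tree theorems over the displayed data `hHD hI hU h₃` only: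
`modelAxioms_of_riemann` with Riemann's theorem (Deligne–Milne 1982 Thm. 6.20, fullness — formerly the displayed
binder `hR`, rows M20 `cmDominated` / M21 `conjIsogeny`) supplied by the tree theorem
`deligneMilne1982_Thm_6_20_full_holds`. -/
theorem modelAxioms_holds (hHD : exists_isReal_hodgeModel) (hI : hodgePQ_independent_of_hodgeModel)
    (hU : BallQuotientUniformisedDatum) (h₃ : CMAbelianVarietyRealised) :
    (universeOf hHD hI hU h₃).ModelAxioms :=
  modelAxioms_of_riemann hHD hI hU h₃ deligneMilne1982_Thm_6_20_full_holds

/-- **The model of record satisfies `ModelAxioms`**: the same statement for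
`Model.picardCMUniverse hHD hI h₁ h₃` (which is `universeOf hHD hI (ballQuotientUniformisedDatum_of h₁) h₃` by `rfl`),
over the displayed data `hHD hI h₁ h₃` only. -/
theorem picardCMUniverse_modelAxioms (hHD : exists_isReal_hodgeModel)
    (hI : hodgePQ_independent_of_hodgeModel) (h₁ : BallQuotientUniformised) (h₃ : CMAbelianVarietyRealised) :
    (picardCMUniverse hHD hI h₁ h₃).ModelAxioms :=
  picardCMUniverse_modelAxioms_of_riemann hHD hI h₁ h₃ deligneMilne1982_Thm_6_20_full_holds

end Model

end Summit.HodgeConjecture.CorCM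

end
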